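import Summits.QuantumFields.BalabanUV.T4Continuum.Support.NE7K1LinTwoRunBonds
import Summits.QuantumFields.BalabanUV.T4Continuum.Support.NE7K1LinFineOpBilinWeight

/-!
# NE7K1LinRunBScales — row NE7 (node U5), candidate route HOM, path H1L, cell K1-lin(s), U = 1 instance of (π6): the two `n²`-SCALE
# facts about run B's block operator — the FLUCTUATION FLOOR `⟨(0,ψ),H_B(0,ψ)⟩ ≥ (2n²∕L^{d+1})‖ψ‖²` (block Poincaré) and the COARSE
# CEILING `⟨(V,0),H_B(V,0)⟩ ≤ L²⟨V,P_AV⟩ ≤ L²(4(d+1)n² + a)‖V‖²` — whose RATIO is mesh-free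

Lineage `b2b-balaban-t4-ne7-p2` (CRUX PROVER NE7 #2), generation 64; the `d₀` and `a₀` inputs of
`NE7K1LinSchurBilinError.bilin_conjError_schur_le` at U = 1.  [folklore]:
* `sum_blockBonds_le` (bonds inside blocks are among all bonds); **`runB_fluct_floor`**: for `ψ` in the fluctuation coordinates,
  `T(0,ψ)` has zero block sums, so block Poincaré (`NE7K1LinTwoRunBonds.blockPoincare_fine`, constant `L²∕2`) and the bond energy
  (`bondEnergy_le_dirichletPart`, coupling `(nL)²`) give `2n²‖ψ‖² ≤ 2n²‖T(0,ψ)‖² ≤ ⟨T(0,ψ), M T(0,ψ)⟩ = L^{d+1}⟨(0,ψ),H_B(0,ψ)⟩`;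
* **`trial_form_le`**: `⟨(V,0),H_B(V,0)⟩ ≤ L²·⟨V,P_AV⟩` (the trial half of `NE7K1LinTwoRunUpper.schurB_form_le`, stated alone);
* **`runA_form_le_norm`**: `⟨V,P_AV⟩ ≤ (4(d+1)n² + a)‖V‖²`.

HONEST FRAMING: [folklore] over the tree's `B4Lower18`; Gaussian (`A = 0`); nothing printed asserted; no `sorry`.  FIXED FINITE T⁴, rung
(B)+1; NE7 NOT PRINTED ∕ NOT PROVED; spine 0∕9; NOT infinite volume, NOT mass gap, NOT Clay.  HONEST DEPENDENCY: continuum YM on T⁴ ⇐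
BetaPertH ∧ nine spine estimates (0/9 proved); BetaPertH ⇐ (D1) ∧ (D4) ∧ CAP+tail; G-an2-4 gates asym, D1 and NE2/3/4.
-/

noncomputable section

open Finset Matrix

namespace Summit.QuantumFields.BalabanUV.T4Continuum.NE7K1LinRunBScales

open Literature.MathematicalPhysics.QuantumFieldTheory.Balaban1983to89
open Literature.MathematicalPhysics.QuantumFieldTheory.Balaban1983to89.B4Reflection242
open Literature.MathematicalPhysics.QuantumFieldTheory.Balaban1983to89.B4BoxCov237
open Literature.MathematicalPhysics.QuantumFieldTheory.Balaban1983to89.B4Lower18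
open Literature.MathematicalPhysics.QuantumFieldTheory.Balaban1983to89.Beta.BlockPoincare (avg)
open Literature.MathematicalPhysics.QuantumFieldTheory.Balaban1983to89.Beta.CombesThomasForm (lap lap_form)
open NE7K1LinSchurLineForm NE7K1LinSchurLineCoords NE7K1LinBlockCoords NE7K1LinSchurLineU1 NE7K1LinTwoRunKit NE7K1LinTwoRunBonds
open NE7K1LinFineOpBilinWeight

variable {d : ℕ} {n L : ℕ} [NeZero L] {R' : Finset (Fin (d + 1) → ℤ)}

omit [NeZero L] in
/-- bonds inside blocks are among all bonds: `Σ_b Σ_{k ⊂ b} g k ≤ Σ_k g k` for `g ≥ 0`. [folklore] -/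
theorem sum_blockBonds_le [NeZero L] (g : RBond R' → ℝ) (hg : ∀ k, 0 ≤ g k) :
    ∑ b : ↥(R'.image (blk L)), ∑ k ∈ Finset.univ.filter
        (fun k : RBond R' => rblk L R' (rsrc k) = b ∧ rblk L R' (rtgt k) = b), g k ≤ ∑ k, g k := by
  classical
  rw [← Finset.sum_fiberwise_of_maps_to (s := (Finset.univ : Finset (RBond R'))) (t := Finset.univ)
    (g := fun k => rblk L R' (rsrc k)) (fun k _ => Finset.mem_univ _) g]
  refine Finset.sum_le_sum fun b _ => Finset.sum_le_sum_of_subset_of_nonneg ?_ fun k _ _ => hg k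
  intro k hk
  simp only [Finset.mem_filter, Finset.mem_univ, true_and] at hk ⊢
  exact hk.1

/-- **THE FLUCTUATION FLOOR OF RUN B**: `(2n²∕L^{d+1})‖ψ‖² ≤ ⟨(0,ψ), H_B(0,ψ)⟩` (`n ≥ 1`, `a ≥ 0`). [folklore] -/
theorem runB_fluct_floor (hn : 1 ≤ n) (hR' : IsBlockUnion (n * L) R') {a : ℝ} (ha : 0 ≤ a)
    (ψ : ↥(R'.image (blk L)) × NZ d L → ℝ) :
    2 * (n : ℝ) ^ 2 / (L : ℝ) ^ (d + 1) * (ψ ⬝ᵥ ψ) ≤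
      Sum.elim (0 : ↥(R'.image (blk L)) → ℝ) ψ ⬝ᵥ (runB (isBlockUnion_fine hR') n a).mulVec
        (Sum.elim (0 : ↥(R'.image (blk L)) → ℝ) ψ) := by
  classical
  have hR'L : IsBlockUnion L R' := isBlockUnion_fine hR'
  have hnL : 1 ≤ n * L := Nat.one_le_iff_ne_zero.2 (Nat.mul_ne_zero (Nat.one_le_iff_ne_zero.1 hn) (NeZero.ne L))
  have hL0 : (0 : ℝ) < L := by exact_mod_cast (NeZero.one_le : 1 ≤ L)
  have hLpow : (0 : ℝ) < (L : ℝ) ^ (d + 1) := by positivity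
  set u : ↥(R'.image (blk L)) ⊕ (↥(R'.image (blk L)) × NZ d L) → ℝ := Sum.elim (0 : ↥(R'.image (blk L)) → ℝ) ψ with hu
  set f := (coordT hR'L).mulVec u with hf
  -- the energy in fine variables
  have hE : u ⬝ᵥ (runB hR'L n a).mulVec u = ((L : ℝ) ^ (d + 1))⁻¹ * (f ⬝ᵥ (fineOpR (n * L) a 0 R').mulVec f) := by
    rw [runB, dot_congr_mulVec]
  -- (i) Dirichlet part bounds the bond energy: `(nL)² Σ_bonds ≤ ⟨f, M f⟩`
  have hbonds : (((n * L : ℕ) : ℝ)) ^ 2 * ∑ k : RBond R', (f (rtgt k) - f (rsrc k)) ^ 2 ≤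
      f ⬝ᵥ (fineOpR (n * L) a 0 R').mulVec f := by
    have hb := bondEnergy_le_dirichletPart (n * L) R' f
    have hd := dirichlet_le_fineOpR_form hnL hR' ha f
    rw [lap_form _ (adjC_symm (n * L) R')] at hd
    have h1 : ∑ x : ↥R', ∑ y : ↥R', adjC (n * L) R' x y * (f x - f y) ^ 2 =
        (((n * L : ℕ) : ℝ)) ^ 2 * ∑ x : ↥R', ∑ y : ↥R', (if y.1 ∈ nbrs x.1 then (f x - f y) ^ 2 else 0) := by
      rw [Finset.mul_sum]
      refine Finset.sum_congr rfl fun x _ => ?_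
      rw [Finset.mul_sum]
      refine Finset.sum_congr rfl fun y _ => ?_
      unfold adjC
      split_ifs <;> push_cast <;> ring
    rw [h1] at hd
    linarith
  -- (ii) block Poincaré on each block (zero block means) and the sum over blocks
  have hmean : ∀ b : ↥(R'.image (blk L)), avg (Finset.univ.filter fun i => rblk L R' i = b) f = 0 := by
    intro b
    rw [avg, hf, blockSum_coordT hR'L u b]
    simp [hu]
  have hblocks : f ⬝ᵥ f ≤ (L : ℝ) ^ 2 / 2 * ∑ k : RBond R', (f (rtgt k) - f (rsrc k)) ^ 2 := by
    have h1 : f ⬝ᵥ f = ∑ b : ↥(R'.image (blk L)), ∑ i ∈ Finset.univ.filter (fun i => rblk L R' i = b), f i ^ 2 := by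
      rw [dotProduct, ← Finset.sum_fiberwise_of_maps_to (s := (Finset.univ : Finset ↥R')) (t := Finset.univ)
        (g := rblk L R') (fun i _ => Finset.mem_univ _)]
      exact Finset.sum_congr rfl fun b _ => Finset.sum_congr rfl fun i _ => by ring
    rw [h1]
    calc ∑ b : ↥(R'.image (blk L)), ∑ i ∈ Finset.univ.filter (fun i => rblk L R' i = b), f i ^ 2
        ≤ ∑ b : ↥(R'.image (blk L)), (L : ℝ) ^ 2 / 2 * ∑ k ∈ Finset.univ.filter
            (fun k : RBond R' => rblk L R' (rsrc k) = b ∧ rblk L R' (rtgt k) = b), (f (rtgt k) - f (rsrc k)) ^ 2 := by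
          refine Finset.sum_le_sum fun b _ => ?_
          have h := blockPoincare_fine hR'L b f
          rw [hmean b] at h
          simpa only [sub_zero] using h
      _ = (L : ℝ) ^ 2 / 2 * ∑ b : ↥(R'.image (blk L)), ∑ k ∈ Finset.univ.filter
            (fun k : RBond R' => rblk L R' (rsrc k) = b ∧ rblk L R' (rtgt k) = b), (f (rtgt k) - f (rsrc k)) ^ 2 := by
          rw [Finset.mul_sum]
      _ ≤ (L : ℝ) ^ 2 / 2 * ∑ k : RBond R', (f (rtgt k) - f (rsrc k)) ^ 2 :=
          mul_le_mul_of_nonneg_left (sum_blockBonds_le _ fun k => sq_nonneg _) (by positivity)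
  -- (iii) `‖ψ‖² ≤ ‖f‖²`
  have hψ : ψ ⬝ᵥ ψ ≤ f ⬝ᵥ f := by
    have h := dot_le_coordT hR'L u
    rw [one_mul] at h
    have : u ⬝ᵥ u = ψ ⬝ᵥ ψ := by rw [hu, sumElim_dotProduct_sumElim, zero_dotProduct, zero_add]
    rw [← this]; exact h
  -- assemble
  rw [hE, div_mul_eq_mul_div, div_le_iff₀ hLpow, mul_comm (((L : ℝ) ^ (d + 1))⁻¹ * _) _, ← mul_assoc,
    mul_inv_cancel₀ hLpow.ne', one_mul]
  have hcast : (((n * L : ℕ) : ℝ)) ^ 2 = (n : ℝ) ^ 2 * (L : ℝ) ^ 2 := by push_cast; ring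
  rw [hcast] at hbonds
  have hL2 : (0 : ℝ) < (L : ℝ) ^ 2 := by positivity
  nlinarith [hbonds, hblocks, hψ, mul_le_mul_of_nonneg_left hblocks (le_of_lt (mul_pos (by positivity : (0:ℝ) < 2 * ((n : ℝ) ^ 2 + 1) + 1) hL2)),
    sq_nonneg (n : ℝ), Finset.sum_nonneg fun (k : RBond R') (_ : k ∈ Finset.univ) => sq_nonneg (f (rtgt k) - f (rsrc k))]

/-- **THE COARSE CEILING, TRIAL FORM**: `⟨(V,0),H_B(V,0)⟩ ≤ L²·⟨V,P_AV⟩` (the trial half of `NE7K1LinTwoRunUpper.schurB_form_le`).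
[folklore] -/
theorem trial_form_le (hn : 1 ≤ n) (hR' : IsBlockUnion (n * L) R') {a : ℝ} (ha : 0 ≤ a) (V : ↥(R'.image (blk L)) → ℝ) :
    Sum.elim V 0 ⬝ᵥ (runB (isBlockUnion_fine hR') n a).mulVec (Sum.elim V 0) ≤ (L : ℝ) ^ 2 * (V ⬝ᵥ (runA n L a R').mulVec V) := by
  classical
  have hL : 1 ≤ L := NeZero.one_le
  have hR'L : IsBlockUnion L R' := isBlockUnion_fine hR'
  have hRc : IsBlockUnion n (R'.image (blk L)) := isBlockUnion_coarse hL hR'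
  have hnL : 1 ≤ n * L := Nat.one_le_iff_ne_zero.2 (Nat.mul_ne_zero (Nat.one_le_iff_ne_zero.1 hn) (NeZero.ne L))
  have hLpow : (0 : ℝ) < (L : ℝ) ^ (d + 1) := pow_pos (by exact_mod_cast hL) _
  have hL1 : (1 : ℝ) ≤ (L : ℝ) := by exact_mod_cast hL
  have hL0 : (L : ℝ) ≠ 0 := by exact_mod_cast (NeZero.ne L)
  rw [runB, dot_congr_mulVec, coordT_inl hR'L V, fineOpR_form hnL hR' a 0, runA, fineOpR_form hn hRc a 0, zero_mul, add_zero,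
    zero_mul, add_zero, mul_add]
  have havg := avgPart_eq hn a (fun x' => V (rblk L R' x')) V (fun b => by
    have := blockSum_coordT hR'L (Sum.elim V 0) b
    rw [coordT_inl hR'L V] at this
    exact this)
  have hdir : ∑ x' : ↥R', ∑ y' : ↥R', (if y'.1 ∈ nbrs x'.1 then (V (rblk L R' x') - V (rblk L R' y')) ^ 2 else 0) ≤
      (L : ℝ) ^ (d + 1) * ∑ x : ↥(R'.image (blk L)), ∑ y : ↥(R'.image (blk L)),
        (if y.1 ∈ nbrs x.1 then (V x - V y) ^ 2 else 0) := by
    rw [← sum_comp_rblk hR'L (fun b => ∑ y : ↥(R'.image (blk L)), (if y.1 ∈ nbrs b.1 then (V b - V y) ^ 2 else 0))]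
    exact Finset.sum_le_sum fun x' _ => fine_nbr_sum_le V x'
  have havg_nn : 0 ≤ a * ((n : ℝ) ^ (d + 1))⁻¹ * ∑ B₀ : ↥((R'.image (blk L)).image (blk n)),
      (∑ b ∈ Finset.univ.filter (fun b => rblk n (R'.image (blk L)) b = B₀), V b) ^ 2 := by
    have : 0 ≤ ∑ B₀ : ↥((R'.image (blk L)).image (blk n)),
        (∑ b ∈ Finset.univ.filter (fun b => rblk n (R'.image (blk L)) b = B₀), V b) ^ 2 :=
      Finset.sum_nonneg fun _ _ => sq_nonneg _
    positivity
  rw [havg, mul_add]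
  have hdir' : ((L : ℝ) ^ (d + 1))⁻¹ * (((n * L : ℕ) : ℝ) ^ 2 / 2 *
      ∑ x' : ↥R', ∑ y' : ↥R', (if y'.1 ∈ nbrs x'.1 then (V (rblk L R' x') - V (rblk L R' y')) ^ 2 else 0)) ≤
      (L : ℝ) ^ 2 * ((n : ℝ) ^ 2 / 2 * ∑ x : ↥(R'.image (blk L)), ∑ y : ↥(R'.image (blk L)),
        (if y.1 ∈ nbrs x.1 then (V x - V y) ^ 2 else 0)) := by
    have h1 := mul_le_mul_of_nonneg_left hdir (show (0 : ℝ) ≤ ((L : ℝ) ^ (d + 1))⁻¹ * (((n * L : ℕ) : ℝ) ^ 2 / 2) by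
      positivity)
    have e : ((L : ℝ) ^ (d + 1))⁻¹ * (((n * L : ℕ) : ℝ) ^ 2 / 2) * ((L : ℝ) ^ (d + 1) *
        ∑ x : ↥(R'.image (blk L)), ∑ y : ↥(R'.image (blk L)), (if y.1 ∈ nbrs x.1 then (V x - V y) ^ 2 else 0)) =
        (L : ℝ) ^ 2 * ((n : ℝ) ^ 2 / 2 * ∑ x : ↥(R'.image (blk L)), ∑ y : ↥(R'.image (blk L)),
          (if y.1 ∈ nbrs x.1 then (V x - V y) ^ 2 else 0)) := by
      push_cast
      field_simp
    rw [← e]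
    linarith [h1]
  have hA := le_mul_of_one_le_left havg_nn (show (1 : ℝ) ≤ (L : ℝ) ^ 2 by nlinarith)
  linarith [hdir', hA]

omit [NeZero L] in
/-- **THE COARSE CEILING, NORM FORM**: `⟨V,P_AV⟩ ≤ (4(d+1)n² + a)‖V‖²` (`n ≥ 1`, `a ≥ 0`, `R` a union of `n`-blocks). [folklore] -/
theorem runA_form_le_norm [NeZero L] (hn : 1 ≤ n) (hRc : IsBlockUnion n (R'.image (blk L))) {a : ℝ} (ha : 0 ≤ a)
    (V : ↥(R'.image (blk L)) → ℝ) :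
    V ⬝ᵥ (runA n L a R').mulVec V ≤ (4 * ((d : ℝ) + 1) * (n : ℝ) ^ 2 + a) * (V ⬝ᵥ V) := by
  classical
  have hn0 : (0 : ℝ) < n := by exact_mod_cast hn
  rw [runA, fineOpR_form hn hRc a 0, zero_mul, add_zero]
  -- Dirichlet part
  have hsq : ∀ x y : ↥(R'.image (blk L)), (V x - V y) ^ 2 ≤ 2 * V x ^ 2 + 2 * V y ^ 2 := fun x y => by
    nlinarith [sq_nonneg (V x + V y)]
  have hD : ∑ x : ↥(R'.image (blk L)), ∑ y : ↥(R'.image (blk L)), (if y.1 ∈ nbrs x.1 then (V x - V y) ^ 2 else (0 : ℝ)) ≤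
      8 * ((d : ℝ) + 1) * (V ⬝ᵥ V) := by
    have h1 := sum_nbr_left_le (R'.image (blk L)) (fun x => 2 * V x ^ 2) (fun x => by positivity)
    have h2 := sum_nbr_right_le (R'.image (blk L)) (fun x => 2 * V x ^ 2) (fun x => by positivity)
    have h3 : ∑ x : ↥(R'.image (blk L)), ∑ y : ↥(R'.image (blk L)), (if y.1 ∈ nbrs x.1 then (V x - V y) ^ 2 else (0 : ℝ)) ≤
        ∑ x : ↥(R'.image (blk L)), ∑ y : ↥(R'.image (blk L)), (if y.1 ∈ nbrs x.1 then 2 * V x ^ 2 else (0 : ℝ)) +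
          ∑ x : ↥(R'.image (blk L)), ∑ y : ↥(R'.image (blk L)), (if y.1 ∈ nbrs x.1 then 2 * V y ^ 2 else (0 : ℝ)) := by
      rw [← Finset.sum_add_distrib]
      refine Finset.sum_le_sum fun x _ => ?_
      rw [← Finset.sum_add_distrib]
      refine Finset.sum_le_sum fun y _ => ?_
      split_ifs
      · exact hsq x y
      · simp
    have hVV : V ⬝ᵥ V = ∑ x, V x ^ 2 := by simp only [dotProduct, sq]
    have h4 : ∑ x : ↥(R'.image (blk L)), 2 * V x ^ 2 = 2 * (V ⬝ᵥ V) := by rw [hVV, Finset.mul_sum]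
    rw [h4] at h1 h2
    linarith
  -- averaging part: Cauchy–Schwarz on each `n`-block
  have hAvg : ((n : ℝ) ^ (d + 1))⁻¹ * ∑ B₀ : ↥((R'.image (blk L)).image (blk n)),
      (∑ b ∈ Finset.univ.filter (fun b => rblk n (R'.image (blk L)) b = B₀), V b) ^ 2 ≤ V ⬝ᵥ V := by
    have hcs : ∀ B₀ : ↥((R'.image (blk L)).image (blk n)),
        (∑ b ∈ Finset.univ.filter (fun b => rblk n (R'.image (blk L)) b = B₀), V b) ^ 2 ≤
          (n : ℝ) ^ (d + 1) * ∑ b ∈ Finset.univ.filter (fun b => rblk n (R'.image (blk L)) b = B₀), V b ^ 2 := by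
      intro B₀
      have h := sq_sum_le_card_mul_sum_sq (s := Finset.univ.filter (fun b => rblk n (R'.image (blk L)) b = B₀)) (f := V)
      rw [card_filter_rblk hn hRc B₀] at h
      push_cast at h
      exact h
    have hsum : ∑ B₀ : ↥((R'.image (blk L)).image (blk n)),
        ∑ b ∈ Finset.univ.filter (fun b => rblk n (R'.image (blk L)) b = B₀), V b ^ 2 = V ⬝ᵥ V := by
      rw [Finset.sum_fiberwise_of_maps_to (s := (Finset.univ : Finset ↥(R'.image (blk L)))) (t := Finset.univ)
        (g := rblk n (R'.image (blk L))) (fun b _ => Finset.mem_univ _)]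
      simp only [dotProduct, sq]
    have hpow : (0 : ℝ) < (n : ℝ) ^ (d + 1) := by positivity
    rw [inv_mul_le_iff₀ hpow, ← hsum, Finset.mul_sum]
    exact Finset.sum_le_sum fun B₀ _ => hcs B₀
  have hnn : 0 ≤ V ⬝ᵥ V := by simp only [dotProduct]; exact Finset.sum_nonneg fun _ _ => mul_self_nonneg _
  have h5 : a * ((n : ℝ) ^ (d + 1))⁻¹ * ∑ B₀ : ↥((R'.image (blk L)).image (blk n)),
      (∑ b ∈ Finset.univ.filter (fun b => rblk n (R'.image (blk L)) b = B₀), V b) ^ 2 ≤ a * (V ⬝ᵥ V) := by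
    rw [mul_assoc]; exact mul_le_mul_of_nonneg_left hAvg ha
  have h6 : (n : ℝ) ^ 2 / 2 * ∑ x : ↥(R'.image (blk L)), ∑ y : ↥(R'.image (blk L)),
      (if y.1 ∈ nbrs x.1 then (V x - V y) ^ 2 else (0 : ℝ)) ≤ 4 * ((d : ℝ) + 1) * (n : ℝ) ^ 2 * (V ⬝ᵥ V) := by
    have := mul_le_mul_of_nonneg_left hD (show (0 : ℝ) ≤ (n : ℝ) ^ 2 / 2 by positivity)
    linarith
  linarith

end Summit.QuantumFields.BalabanUV.T4Continuum.NE7K1LinRunBScales
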